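import Summits.CriticalPhenomena.SAWScalingLimit.Theorems.SAWRenewalTightnessStripMassConservation
import Mathlib.Topology.Instances.ENNReal.Lemmas
import HarnessLib

/-!
# Line `kesten-product-renewal-dictionary` for the crux `SAWTotalPositivity.CriticalBubbleBound`
(stmt-CriticalPhenomena-7117): stub S9 — the EFFECTIVE critical strip mass bound, transferred to
vertex functions

The `n`-step self-avoiding walks of `ℤ²` from the origin confined to a vertical strip of width `h`,
`{ω ∈ Zd.saws 2 n : ∀ i i' ≤ n, ω₁(i) ≤ ω₁(i') + h}` (all first coordinates within `h` of each other),
have critical generating function `Σ_n #{…} x_c^n ≤ 2 μ 4^h`, where `x_c = criticalFugacity = 1/μ` and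
`μ = connectiveConstant` (Madras–Slade 1993, §3.1 with §4.2: a walk in a strip of width `h` unfolds into
at most `2 · 4^h`-to-few half-space pieces whose critical mass is controlled by Kesten's bridge bound).

**Hypothesis** (stub S8 of the line, the word model of `SAWWords.lean` / `SAWWordBridges.lean`): for all
`N h`, the `x_c`-mass of the self-avoiding step WORDS `w` of length `≤ N` confined to width `h`
(`∀ i i' ≤ |w|, xAt w i ≤ xAt w i' + h`) is at most `2 μ 4^h`.

**Proved here** (`stripMass_le_exp_of`), the transfer of that bound to vertex functions:
* `card_saws_filter_strip_le` — for each length `n` the confined vertex functions `ω ∈ Zd.saws 2 n` inject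
  into the confined words of length `n` by reading off the step word `wordOf n ω` (left inverse
  `traj_wordOf`, so `xAt (wordOf n ω) i = ω₁(i)` and the width predicate is preserved);
* `sum_range_stripCount_le_wordSum` — hence the real partial sums `Σ_{n ≤ N} #{…} x_c^n` are at most the
  word mass of the hypothesis (the word sets of different lengths are disjoint, `Finset.sum_biUnion`);
* `sum_range_stripCount_eq_ofReal` and `ENNReal.tsum_eq_iSup_nat` — the `ℝ≥0∞` series is the supremum
  of its partial sums, each of which is `ENNReal.ofReal` of a real partial sum `≤ 2 μ 4^h`.

Sources: N. Madras, G. Slade, *The Self-Avoiding Walk* (1993), §1.1 (words versus vertex functions),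
§3.1 (Hammersley–Welsh unfolding), §4.2 (Kesten's renewal structure); H. Kesten, *On the number of
self-avoiding walks*, J. Math. Phys. 4 (1963), §4.
Deliberately NOT here: the word-model bound S8 itself (another file of the line).
-/

noncomputable section

open Literature.Probability.LatticeModels
open Literature.Probability.RandomPlanarGeometry Literature.Probability.RandomPlanarGeometry.SAW
open scoped ENNReal NNReal BigOperators
open Classical

namespace Summit.CriticalPhenomena.SAWScalingLimit.Theorems.CriticalBubbleBound.Kesten.HW

/-! ## Confined vertex functions inject into confined words -/

/-- The `n`-step self-avoiding vertex functions confined to a strip of width `h` inject into the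
self-avoiding words of length `n` confined to width `h`, by reading off the step word (`wordOf`,
left inverse `traj_wordOf`, which identifies `xAt (wordOf n ω) i` with `ω₁(i)`).
[cite: MadrasSlade1993, §1.1] -/
theorem card_saws_filter_strip_le (n h : ℕ) :
    ((Zd.saws 2 n).filter (fun ω => ∀ i ≤ n, ∀ i' ≤ n, ω i 0 ≤ ω i' 0 + (h : ℤ))).card ≤
      ((sawWords n).filter
        (fun w => ∀ i ≤ w.length, ∀ i' ≤ w.length, xAt w i ≤ xAt w i' + (h : ℤ))).card := by
  refine Finset.card_le_card_of_injOn (fun ω => wordOf n ω) (fun ω hω => ?_) ?_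
  · rw [Finset.mem_coe, Finset.mem_filter] at hω
    obtain ⟨hω, hwidth⟩ := hω
    have hsaw : IsSAW (wordOf n ω) := by
      rw [isSAW_iff_injOn, traj_wordOf hω, length_wordOf]
      exact (Zd.mem_saws.1 hω).2.2.2
    rw [Finset.mem_coe, Finset.mem_filter, mem_sawWords]
    refine ⟨⟨length_wordOf n ω, hsaw⟩, fun i hi i' hi' => ?_⟩
    rw [length_wordOf] at hi hi'
    show traj (wordOf n ω) i 0 ≤ traj (wordOf n ω) i' 0 + (h : ℤ)
    rw [traj_wordOf hω]
    exact hwidth i hi i' hi'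
  · intro ω hω ω' hω' heq
    rw [Finset.mem_coe, Finset.mem_filter] at hω hω'
    have heq' : wordOf n ω = wordOf n ω' := heq
    calc ω = traj (wordOf n ω) := (traj_wordOf hω.1).symm
      _ = traj (wordOf n ω') := by rw [heq']
      _ = ω' := traj_wordOf hω'.1

/-! ## The real partial sums are bounded by the word mass -/

/-- **Transfer to the word model.** The real partial sums `Σ_{n ≤ N} #{confined ω ∈ Zd.saws 2 n} x_c^n`
are at most the critical mass of the confined self-avoiding WORDS of length `≤ N`: per length the
confined vertex functions inject into the confined words (`card_saws_filter_strip_le`), and the word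
sets of different lengths are disjoint. [cite: MadrasSlade1993, §1.1] -/
theorem sum_range_stripCount_le_wordSum (h N : ℕ) :
    ∑ n ∈ Finset.range (N + 1),
        (((Zd.saws 2 n).filter (fun ω => ∀ i ≤ n, ∀ i' ≤ n, ω i 0 ≤ ω i' 0 + (h : ℤ))).card : ℝ) *
          criticalFugacity ^ n ≤
      ∑ w ∈ (Finset.range (N + 1)).biUnion
          (fun n => (sawWords n).filter
            (fun w => ∀ i ≤ w.length, ∀ i' ≤ w.length, xAt w i ≤ xAt w i' + (h : ℤ))),
        criticalFugacity ^ w.length := by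
  have hxc : 0 ≤ criticalFugacity := StripMass.criticalFugacity_pos.le
  -- per length `n`: the word sum is a constant sum, compare the cardinalities
  have hstep : ∀ n : ℕ,
      (((Zd.saws 2 n).filter (fun ω => ∀ i ≤ n, ∀ i' ≤ n, ω i 0 ≤ ω i' 0 + (h : ℤ))).card : ℝ) *
          criticalFugacity ^ n ≤
        ∑ w ∈ (sawWords n).filter
            (fun w => ∀ i ≤ w.length, ∀ i' ≤ w.length, xAt w i ≤ xAt w i' + (h : ℤ)),
          criticalFugacity ^ w.length := by
    intro n
    have h2 : ∑ w ∈ (sawWords n).filter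
            (fun w => ∀ i ≤ w.length, ∀ i' ≤ w.length, xAt w i ≤ xAt w i' + (h : ℤ)),
          criticalFugacity ^ w.length =
        ∑ _w ∈ (sawWords n).filter
            (fun w => ∀ i ≤ w.length, ∀ i' ≤ w.length, xAt w i ≤ xAt w i' + (h : ℤ)),
          criticalFugacity ^ n :=
      Finset.sum_congr rfl fun w hw => by rw [(mem_sawWords.1 (Finset.mem_filter.1 hw).1).1]
    rw [h2, Finset.sum_const, nsmul_eq_mul]
    exact mul_le_mul_of_nonneg_right (Nat.cast_le.2 (card_saws_filter_strip_le n h))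
      (pow_nonneg hxc _)
  -- the sets of words of different lengths are disjoint
  have hdisj : Set.PairwiseDisjoint (↑(Finset.range (N + 1)) : Set ℕ)
      (fun n => (sawWords n).filter
        (fun w => ∀ i ≤ w.length, ∀ i' ≤ w.length, xAt w i ≤ xAt w i' + (h : ℤ))) := by
    intro m _ n _ hmn
    rw [Function.onFun, Finset.disjoint_left]
    intro w hwm hwn
    exact hmn ((mem_sawWords.1 (Finset.mem_filter.1 hwm).1).1.symm.trans
      (mem_sawWords.1 (Finset.mem_filter.1 hwn).1).1)
  refine (Finset.sum_le_sum fun n _ => hstep n).trans ?_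
  rw [← Finset.sum_biUnion hdisj]

/-! ## `ℝ≥0∞` bookkeeping -/

/-- The `ℝ≥0∞` partial sums of the confined critical series, pushed through `ENNReal.ofReal`
(all terms are non-negative reals). [folklore] -/
theorem sum_range_stripCount_eq_ofReal (h N : ℕ) :
    ∑ n ∈ Finset.range (N + 1),
        (((Zd.saws 2 n).filter (fun ω => ∀ i ≤ n, ∀ i' ≤ n, ω i 0 ≤ ω i' 0 + (h : ℤ))).card : ℝ≥0∞) *
          ENNReal.ofReal (criticalFugacity ^ n) =
      ENNReal.ofReal (∑ n ∈ Finset.range (N + 1),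
        (((Zd.saws 2 n).filter (fun ω => ∀ i ≤ n, ∀ i' ≤ n, ω i 0 ≤ ω i' 0 + (h : ℤ))).card : ℝ) *
          criticalFugacity ^ n) := by
  have hx : 0 ≤ criticalFugacity := StripMass.criticalFugacity_pos.le
  rw [ENNReal.ofReal_sum_of_nonneg fun n _ => mul_nonneg (Nat.cast_nonneg _) (pow_nonneg hx n)]
  refine Finset.sum_congr rfl fun n _ => ?_
  rw [ENNReal.ofReal_mul (Nat.cast_nonneg _), ENNReal.ofReal_natCast]

/-! ## The effective critical strip mass bound -/

/-- **Effective critical strip mass bound** (stub S9 of the line). From the word-model bound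
`Σ_{confined SAW words w of width h, |w| ≤ N} x_c^{|w|} ≤ 2 μ 4^h` (stub S8): the critical generating
function of the self-avoiding walks of `ℤ²` from the origin confined to a vertical strip of width `h`
satisfies `Σ_n #{ω ∈ Zd.saws 2 n : ∀ i i' ≤ n, ω₁(i) ≤ ω₁(i') + h} x_c^n ≤ 2 μ 4^h` in `ℝ≥0∞`
(the series is the supremum of its partial sums, each transferred to the word model by
`sum_range_stripCount_le_wordSum`). [cite: MadrasSlade1993, §3.1; §4.2] -/
theorem stripMass_le_exp_of : (∀ N h : ℕ, (∑ w ∈ (Finset.range (N + 1)).biUnion (fun n => (sawWords n).filter (fun w => ∀ i ≤ w.length, ∀ i' ≤ w.length, xAt w i ≤ xAt w i' + (h : ℤ))), criticalFugacity ^ w.length) ≤ 2 * connectiveConstant * 4 ^ h) → ∀ h : ℕ, (∑' n : ℕ, (((Zd.saws 2 n).filter (fun ω => ∀ i ≤ n, ∀ i' ≤ n, ω i 0 ≤ ω i' 0 + (h : ℤ))).card : ℝ≥0∞) * ENNReal.ofReal (criticalFugacity ^ n)) ≤ ENNReal.ofReal (2 * connectiveConstant * 4 ^ h) := by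
  intro hyp h
  rw [ENNReal.tsum_eq_iSup_nat]
  refine iSup_le fun N => ?_
  calc ∑ n ∈ Finset.range N,
          (((Zd.saws 2 n).filter (fun ω => ∀ i ≤ n, ∀ i' ≤ n, ω i 0 ≤ ω i' 0 + (h : ℤ))).card : ℝ≥0∞) *
            ENNReal.ofReal (criticalFugacity ^ n)
      ≤ ∑ n ∈ Finset.range (N + 1),
          (((Zd.saws 2 n).filter (fun ω => ∀ i ≤ n, ∀ i' ≤ n, ω i 0 ≤ ω i' 0 + (h : ℤ))).card : ℝ≥0∞) *
            ENNReal.ofReal (criticalFugacity ^ n) :=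
        Finset.sum_le_sum_of_subset (Finset.range_subset_range.2 (Nat.le_succ N))
    _ = ENNReal.ofReal (∑ n ∈ Finset.range (N + 1),
          (((Zd.saws 2 n).filter (fun ω => ∀ i ≤ n, ∀ i' ≤ n, ω i 0 ≤ ω i' 0 + (h : ℤ))).card : ℝ) *
            criticalFugacity ^ n) :=
        sum_range_stripCount_eq_ofReal h N
    _ ≤ ENNReal.ofReal (2 * connectiveConstant * 4 ^ h) :=
        ENNReal.ofReal_le_ofReal ((sum_range_stripCount_le_wordSum h N).trans (hyp N h))

end Summit.CriticalPhenomena.SAWScalingLimit.Theorems.CriticalBubbleBound.Kesten.HW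

end
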